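import Mathlib

/-!
# T5DoubleCosetDecomposition — the adelic ↔ classical double-coset decomposition (group-theoretic half)

Kernel annex of the blind cell `pub-hodge-repro2`, seat p2, Tier-5 sub-step N1 (route/T5-ID-p2.md, §ID-4(b′)).

The prose step formalised here is the bookkeeping identity behind «the integral over `[G]/K` is the
sum over the components `Γ_j\G_∞`»:

  `G(F⁺) \ (G_∞ × G(𝔸_f)) / ({1} × K)  ≅  ⊔_j  Γ_j \ G_∞`,

where `g_j` runs over representatives of the finite double-coset space `G(F⁺) \ G(𝔸_f) / K` and
`Γ_j = G(F⁺) ∩ g_j K g_j⁻¹` (acting on `G_∞` through the archimedean embedding).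

Abstractly: `A` (= `G_∞`) and `B` (= `G(𝔸_f)`) are groups, `H ≤ A × B` (= `G(F⁺)` embedded
diagonally), `K ≤ B`.  Then `H \ (A × B) / ({1} × K)` is in bijection with
`Σ (q : H_B \ B / K), Γ_q \ A`, where `H_B` is the image of `H` in `B`, `g_q = q.out`, and
`Γ_q = {h_A : h ∈ H, h_B ∈ g_q K g_q⁻¹}`.

What stays prose (not Mathlib-expressible here): the FINITENESS of `H_B \ B / K` (compact-open `K`,
discreteness of `G(F⁺)` in `G(𝔸)` — adelic input), and the passage `Γ_j \ G_∞ → Γ_j \ 𝔹²` (B1/B2).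

Double cosets are Mathlib's `DoubleCoset.Quotient`; the right-coset space `Γ \ A` is
`Quotient (QuotientGroup.rightRel Γ)`.
-/

namespace Summit.Ventures.HodgeRepro2.T5DoubleCosetDecomposition

universe u v

variable {A : Type u} {B : Type v} [Group A] [Group B]

/-- The subgroup `{1} × K` of `A × B` (the level acts on the finite factor only). -/
def rightLevel (A : Type u) [Group A] (K : Subgroup B) : Subgroup (A × B) :=
  (⊥ : Subgroup A).prod K

/-- Membership in `{1} × K`. -/
theorem mem_rightLevel {K : Subgroup B} {p : A × B} :
    p ∈ rightLevel A K ↔ p.1 = 1 ∧ p.2 ∈ K := by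
  simp [rightLevel, Subgroup.mem_prod]

/-- The image `H_B` of `H ≤ A × B` in the second factor `B`. -/
def imageSnd (H : Subgroup (A × B)) : Subgroup B :=
  H.map (MonoidHom.snd A B)

/-- Membership in the image `H_B`. -/
theorem mem_imageSnd {H : Subgroup (A × B)} {b : B} :
    b ∈ imageSnd H ↔ ∃ h ∈ H, h.2 = b :=
  Iff.rfl

/-- The finite-part double-coset space `H_B \ B / K`. -/
abbrev FiniteQuotient (H : Subgroup (A × B)) (K : Subgroup B) : Type _ :=
  DoubleCoset.Quotient (imageSnd H : Set B) (K : Set B)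

/-- The full double-coset space `H \ (A × B) / ({1} × K)`. -/
abbrev FullQuotient (H : Subgroup (A × B)) (K : Subgroup B) : Type _ :=
  DoubleCoset.Quotient (H : Set (A × B)) (rightLevel A K : Set (A × B))

/-- A chosen representative `g_q ∈ B` of the finite double coset `q`. -/
noncomputable def rep {H : Subgroup (A × B)} {K : Subgroup B} (q : FiniteQuotient H K) : B :=
  q.out

/-- The representative represents: `H_B g_q K = q`. -/
theorem mk_rep {H : Subgroup (A × B)} {K : Subgroup B} (q : FiniteQuotient H K) :
    DoubleCoset.mk (imageSnd H) K (rep q) = q :=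
  DoubleCoset.out_eq' _ _ q

/-- The arithmetic group `Γ_g = {h_A : h ∈ H, h_B ∈ g K g⁻¹} ≤ A` attached to `g ∈ B`. -/
def gammaGroup (H : Subgroup (A × B)) (K : Subgroup B) (g : B) : Subgroup A where
  carrier := {a | ∃ h ∈ H, h.1 = a ∧ ∃ k ∈ K, h.2 = g * k * g⁻¹}
  one_mem' := ⟨1, H.one_mem, rfl, 1, K.one_mem, by simp⟩
  mul_mem' := by
    rintro a a' ⟨h, hH, rfl, k, hk, hk'⟩ ⟨h', hH', rfl, k', hk'', hk'''⟩
    refine ⟨h * h', H.mul_mem hH hH', rfl, k * k', K.mul_mem hk hk'', ?_⟩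
    simp only [Prod.snd_mul, hk', hk''']
    group
  inv_mem' := by
    rintro a ⟨h, hH, rfl, k, hk, hk'⟩
    refine ⟨h⁻¹, H.inv_mem hH, rfl, k⁻¹, K.inv_mem hk, ?_⟩
    simp only [Prod.snd_inv, hk']
    group

/-- Membership in `Γ_g`. -/
theorem mem_gammaGroup {H : Subgroup (A × B)} {K : Subgroup B} {g : B} {a : A} :
    a ∈ gammaGroup H K g ↔ ∃ h ∈ H, h.1 = a ∧ ∃ k ∈ K, h.2 = g * k * g⁻¹ :=
  Iff.rfl

/-- When `H` is the image of a group `C` under a pair of homomorphisms `φ : C →* A`,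
`ψ : C →* B` (the arithmetic situation: `C = G(F⁺)`, `φ` the archimedean embedding, `ψ` the
finite-adelic one), `Γ_g` is the image under `φ` of `ψ⁻¹(g K g⁻¹)` — the classical
`Γ_g = G(F⁺) ∩ g K g⁻¹`. -/
theorem mem_gammaGroup_range {C : Type*} [Group C] (φ : C →* A) (ψ : C →* B)
    {K : Subgroup B} {g : B} {a : A} :
    a ∈ gammaGroup (φ.prod ψ).range K g ↔ ∃ c, φ c = a ∧ ∃ k ∈ K, ψ c = g * k * g⁻¹ := by
  constructor
  · rintro ⟨h, ⟨c, rfl⟩, rfl, k, hk, hk'⟩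
    exact ⟨c, rfl, k, hk, hk'⟩
  · rintro ⟨c, rfl, k, hk, hk'⟩
    exact ⟨φ.prod ψ c, ⟨c, rfl⟩, rfl, k, hk, hk'⟩

/-- The right-coset space `Γ_q \ A` of the component attached to `q`. -/
abbrev Component (H : Subgroup (A × B)) (K : Subgroup B) (q : FiniteQuotient H K) : Type _ :=
  Quotient (QuotientGroup.rightRel (gammaGroup H K (rep q)))

/-- Two points of `A` define the same double coset `H (a, g) ({1} × K)` as soon as they lie in
the same `Γ_g`-orbit. -/
theorem mk_eq_mk_of_rightRel {H : Subgroup (A × B)} {K : Subgroup B} {g : B} {a a' : A}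
    (hrel : QuotientGroup.rightRel (gammaGroup H K g) a a') :
    DoubleCoset.mk H (rightLevel A K) (a, g) = DoubleCoset.mk H (rightLevel A K) (a', g) := by
  rw [QuotientGroup.rightRel_apply] at hrel
  obtain ⟨h, hH, hh1, k, hk, hh2⟩ := hrel
  rw [DoubleCoset.eq]
  refine ⟨h, hH, (1, k⁻¹), mem_rightLevel.2 ⟨rfl, K.inv_mem hk⟩, ?_⟩
  ext
  · simp only [Prod.fst_mul, hh1, mul_one]
    group
  · simp only [Prod.snd_mul, hh2]
    group

/-- The map `Γ_q \ A → H \ (A × B) / ({1} × K)`, `Γ_q a ↦ H (a, g_q) ({1} × K)`. -/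
noncomputable def toFull {H : Subgroup (A × B)} {K : Subgroup B} (q : FiniteQuotient H K)
    (x : Component H K q) : FullQuotient H K :=
  Quotient.liftOn' x (fun a => DoubleCoset.mk H (rightLevel A K) (a, rep q))
    (fun _ _ hrel => mk_eq_mk_of_rightRel hrel)

/-- `toFull` on a representative: `Γ_q a ↦ H (a, g_q) ({1} × K)`. -/
@[simp]
theorem toFull_mk {H : Subgroup (A × B)} {K : Subgroup B} (q : FiniteQuotient H K) (a : A) :
    toFull q (Quotient.mk'' a) = DoubleCoset.mk H (rightLevel A K) (a, rep q) :=
  rfl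

/-- The finite part of a full double coset: `H (a, b) ({1} × K) ↦ H_B b K`. -/
def finitePart {H : Subgroup (A × B)} {K : Subgroup B} (t : FullQuotient H K) :
    FiniteQuotient H K :=
  Quotient.liftOn' t (fun p => DoubleCoset.mk (imageSnd H) K p.2) (by
    intro p p' hpp'
    obtain ⟨h, hH, k, hk, rfl⟩ := DoubleCoset.rel_iff.1 hpp'
    rw [DoubleCoset.eq]
    exact ⟨h.2, ⟨h, hH, rfl⟩, k.2, (mem_rightLevel.1 hk).2, rfl⟩)

/-- `finitePart` on a representative: `H (a, b) ({1} × K) ↦ H_B b K`. -/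
@[simp]
theorem finitePart_mk {H : Subgroup (A × B)} {K : Subgroup B} (p : A × B) :
    finitePart (DoubleCoset.mk H (rightLevel A K) p) = DoubleCoset.mk (imageSnd H) K p.2 :=
  rfl

/-- The components are fibred over the finite double-coset space: `toFull q x` has finite part `q`. -/
theorem finitePart_toFull {H : Subgroup (A × B)} {K : Subgroup B} (q : FiniteQuotient H K)
    (x : Component H K q) : finitePart (toFull q x) = q := by
  induction x using Quotient.inductionOn' with
  | h a => simp [mk_rep]

/-- Injectivity of the assembled map `Σ q, Γ_q \ A → H \ (A × B) / ({1} × K)`. -/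
theorem toFull_injective {H : Subgroup (A × B)} {K : Subgroup B} :
    Function.Injective (fun p : Σ q : FiniteQuotient H K, Component H K q => toFull p.1 p.2) := by
  rintro ⟨q, x⟩ ⟨q', x'⟩ hxx'
  -- the finite parts agree, so `q = q'`
  have hq : q = q' := by
    have := congrArg finitePart hxx'
    simpa only [finitePart_toFull] using this
  subst hq
  -- now compare inside one component
  induction x using Quotient.inductionOn' with
  | h a =>
    induction x' using Quotient.inductionOn' with
    | h a' =>
      simp only [toFull_mk] at hxx'
      obtain ⟨h, hH, k, hk, hprod⟩ := (DoubleCoset.eq _ _ _ _).1 hxx'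
      obtain ⟨hk1, hk2⟩ := mem_rightLevel.1 hk
      have h1 : a' = h.1 * a := by
        have := congrArg Prod.fst hprod
        simpa only [Prod.fst_mul, hk1, mul_one] using this
      have h2 : h.2 = rep q * k.2⁻¹ * (rep q)⁻¹ := by
        have hsnd : rep q = h.2 * rep q * k.2 := by
          have := congrArg Prod.snd hprod
          simpa only [Prod.snd_mul] using this
        calc h.2 = (h.2 * rep q * k.2) * k.2⁻¹ * (rep q)⁻¹ := by group
          _ = rep q * k.2⁻¹ * (rep q)⁻¹ := by rw [← hsnd]
      congr 1
      apply Quotient.sound'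
      rw [QuotientGroup.rightRel_apply]
      refine ⟨h, hH, ?_, k.2⁻¹, K.inv_mem hk2, h2⟩
      rw [h1]
      group

/-- Surjectivity of the assembled map: every double coset `H (a, b) ({1} × K)` is
`H (h_A a, g_q) ({1} × K)` for `q = H_B b K` and a suitable `h ∈ H`. -/
theorem toFull_surjective {H : Subgroup (A × B)} {K : Subgroup B} :
    Function.Surjective (fun p : Σ q : FiniteQuotient H K, Component H K q => toFull p.1 p.2) := by
  intro t
  induction t using Quotient.inductionOn' with
  | h p =>
    obtain ⟨a, b⟩ := p
    set q : FiniteQuotient H K := DoubleCoset.mk (imageSnd H) K b with hq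
    obtain ⟨hb, k, hhb, hk, hout⟩ := DoubleCoset.mk_out_eq_mul (imageSnd H) K b
    obtain ⟨h, hH, rfl⟩ := mem_imageSnd.1 hhb
    refine ⟨⟨q, Quotient.mk'' (h.1 * a)⟩, ?_⟩
    show DoubleCoset.mk H (rightLevel A K) (h.1 * a, rep q) = DoubleCoset.mk H (rightLevel A K) (a, b)
    symm
    rw [DoubleCoset.eq]
    refine ⟨h, hH, (1, k), mem_rightLevel.2 ⟨rfl, hk⟩, ?_⟩
    ext
    · simp
    · simp only [Prod.snd_mul]
      exact hout

/-- For fixed `q`, `Γ_q a ↦ H (a, g_q) ({1} × K)` is injective: `Γ_q \ A` embeds in the full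
double-coset space. -/
theorem toFull_inj {H : Subgroup (A × B)} {K : Subgroup B} (q : FiniteQuotient H K)
    {x x' : Component H K q} (h : toFull q x = toFull q x') : x = x' := by
  have := @toFull_injective A B _ _ H K ⟨q, x⟩ ⟨q, x'⟩ h
  exact eq_of_heq (Sigma.mk.inj_iff.1 this).2

/-- The image of `Γ_q \ A` in the full double-coset space is exactly the fibre of `finitePart`
over `q` — the «component» `A_q` of the partition used in the integral bookkeeping. -/
theorem range_toFull {H : Subgroup (A × B)} {K : Subgroup B} (q : FiniteQuotient H K) :
    Set.range (toFull q) = finitePart ⁻¹' {q} := by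
  ext t
  constructor
  · rintro ⟨x, rfl⟩
    exact finitePart_toFull q x
  · intro ht
    obtain ⟨⟨q', x⟩, rfl⟩ := toFull_surjective t
    have hq : q' = q := by simpa only [Set.mem_preimage, Set.mem_singleton_iff, finitePart_toFull]
      using ht
    subst hq
    exact ⟨x, rfl⟩

/-- The components cover the full double-coset space. -/
theorem iUnion_range_toFull {H : Subgroup (A × B)} {K : Subgroup B} :
    ⋃ q : FiniteQuotient H K, Set.range (toFull q) = Set.univ := by
  simp only [range_toFull]
  ext t
  simp

open Function in
/-- Distinct components are disjoint. -/
theorem pairwise_disjoint_range_toFull {H : Subgroup (A × B)} {K : Subgroup B} :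
    Pairwise (Disjoint on fun q : FiniteQuotient H K => Set.range (toFull q)) := by
  simp only [range_toFull]
  exact pairwise_disjoint_fiber finitePart

/-- THE DECOMPOSITION: `Σ (q : H_B \ B / K), Γ_q \ A  ≃  H \ (A × B) / ({1} × K)` —
«`[G]/K = ⊔_j Γ_j \ G_∞`». -/
noncomputable def decomposition (H : Subgroup (A × B)) (K : Subgroup B) :
    (Σ q : FiniteQuotient H K, Component H K q) ≃ FullQuotient H K :=
  Equiv.ofBijective _ ⟨toFull_injective, toFull_surjective⟩

/-- The decomposition is the assembled map `⟨q, x⟩ ↦ toFull q x`. -/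
@[simp]
theorem decomposition_apply {H : Subgroup (A × B)} {K : Subgroup B}
    (p : Σ q : FiniteQuotient H K, Component H K q) :
    decomposition H K p = toFull p.1 p.2 :=
  rfl

/-- The decomposition is compatible with the finite parts: the component index of a double coset
is its finite part. -/
theorem fst_symm_decomposition {H : Subgroup (A × B)} {K : Subgroup B} (t : FullQuotient H K) :
    ((decomposition H K).symm t).1 = finitePart t := by
  conv_rhs => rw [← (decomposition H K).apply_symm_apply t]
  rw [decomposition_apply, finitePart_toFull]

/-- Finitely many finite double cosets ⇒ the full quotient is a FINITE disjoint union of the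
components `Γ_q \ A` (the index type of the decomposition is finite). -/
theorem finite_index_of_finite {H : Subgroup (A × B)} {K : Subgroup B}
    [Finite (FiniteQuotient H K)] :
    ∃ (ι : Type v) (_ : Finite ι) (Γ : ι → Subgroup A),
      Nonempty (FullQuotient H K ≃ Σ i : ι, Quotient (QuotientGroup.rightRel (Γ i))) :=
  ⟨FiniteQuotient H K, inferInstance, fun q => gammaGroup H K (rep q),
    ⟨(decomposition H K).symm⟩⟩

/-- Sanity check: with `H = ⊥` the finite quotient is `B / K` and every `Γ_q` is trivial. -/
theorem gammaGroup_bot {K : Subgroup B} (g : B) :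
    gammaGroup (⊥ : Subgroup (A × B)) K g = ⊥ := by
  ext a
  rw [mem_gammaGroup, Subgroup.mem_bot]
  constructor
  · rintro ⟨h, hh, rfl, -⟩
    rw [Subgroup.mem_bot] at hh
    rw [hh]
    rfl
  · rintro rfl
    exact ⟨1, Subgroup.one_mem _, rfl, 1, K.one_mem, by simp⟩

/-- Sanity check: with `K = ⊤` the finite quotient is a point and `Γ_g` is the projection of `H`
to `A` for every `g`. -/
theorem gammaGroup_top {H : Subgroup (A × B)} (g : B) :
    gammaGroup H ⊤ g = H.map (MonoidHom.fst A B) := by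
  ext a
  rw [mem_gammaGroup, Subgroup.mem_map]
  constructor
  · rintro ⟨h, hH, rfl, -⟩
    exact ⟨h, hH, rfl⟩
  · rintro ⟨h, hH, rfl⟩
    exact ⟨h, hH, rfl, g⁻¹ * h.2 * g, Subgroup.mem_top _, by group⟩

end Summit.Ventures.HodgeRepro2.T5DoubleCosetDecomposition
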